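import Summits.KontsevichZagierPeriods.KontsevichZagierPeriods.Theorems.StuffleInKZ.Negative.Core

/-!
# `StuffleInKZ` (stmt-KontsevichZagierPeriods-3931): negative side — the additivity-only
# sub-calculus cannot prove the stuffle (a change of variables or a Newton–Leibniz move is necessary)

Companion of `Negative/Core.lean` (cdisprove unit of the crux `StuffleInKZ`, route
`FurushoPentagon`). The invariant: **localised evaluation** `locEval A [σ, f] = ∫_{σ ∩ A_k} f`
against a family of measurable test sets `A_k ⊆ ℝᵏ` is additive and kills both additivity moves
(1a) (domain) and (1b) (integrand) — the same computation as their soundness, restricted to `A` —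
so it vanishes on `addRelations = closure (domainAddRel ∪ integrandAddRel)`. With the test set
`A₄ = {z | z₁ < z₂}`: every ordered simplex `Δ₄ = {1 > z₀ > z₁ > z₂ > z₃ > 0}` (the common domain
of ALL stuffle terms `[Δ_{2,2}]`, `[Δ_{2,2}]`, `[Δ_4]`) misses `A₄`, while the product domain
`Δ₂ × Δ₂ = {1 > z₀ > z₁ > 0} × {1 > z₂ > z₃ > 0}` meets it in a nonempty open set on which the
positive integrand `ω₀ω₁ ⊗ ω₀ω₁` has positive integral. Hence the first genuine stuffle defect
`[Δ₂]² − 2[Δ_{2,2}] − [Δ_4]` is NOT in `addRelations` (`defect_two_two_not_mem_addRelations`) and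
the crux with `relations` replaced by `addRelations` is false (`not_stuffleInAdd`): together with
`not_stuffleInCovNL` (`LoadBearing.lean`), every move chain proving the stuffle contains at least
one additivity move AND at least one change of variables or Newton–Leibniz move. (The expected
proof — Soudères 2010, Prop. 1.5, cubical coordinates — uses exactly (1b) + (2).) Whether a change
of variables specifically is necessary, i.e. whether the defect lies outside
`closure (domainAddRel ∪ integrandAddRel ∪ newtonLeibnizRel)`, is open: no invariant compatible with
Newton–Leibniz other than `eval` is known to us.

Sources: M. Kontsevich, D. Zagier, *Periods* (2001), §1.2 rules (1a), (1b); I. Soudères,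
*Motivic double shuffle*, Int. J. Number Theory 6 (2010), Prop. 1.5.
-/

noncomputable section

namespace Summit.KontsevichZagierPeriods.Theorems.StuffleInKZ.Negative

open MeasureTheory Set
open Literature.NumberTheory.Transcendental
open Literature.NumberTheory.Transcendental.KZ
open Literature.NumberTheory.Transcendental.MZV (IsAdmissible stuffle weight isAdmissible_nil
  isAdmissible_of_mem_stuffle stuffle_cons_cons stuffle_nil_left stuffle_nil_right sum_of_mem_stuffle)
open Summit.KontsevichZagierPeriods.KontsevichZagierPeriods.Theses.FurushoPentagon (StuffleInKZ)

variable {n m : ℕ}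

/-! ## §1 Localised evaluation kills the additivity moves -/

/-- The closure of the two additivity moves (1a), (1b) alone. [folklore] -/
def addRelations : AddSubgroup FormalRep := AddSubgroup.closure (domainAddRel ∪ integrandAddRel)

/-- The additivity closure is part of `relations`. [folklore] -/
theorem addRelations_le_relations : addRelations ≤ relations :=
  AddSubgroup.closure_mono fun _ hc => Or.inl (Or.inl hc)

/-- **Localised evaluation** against a family of test sets `A k ⊆ ℝᵏ`: `[σ, f] ↦ ∫_{σ ∩ A_k} f`.
[folklore] -/
def locEval (A : ∀ k, Set (Fin k → ℝ)) : FormalRep →+ ℝ :=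
  FreeAbelianGroup.lift fun r => ∫ x in r.2.domain ∩ A r.1, r.2.integrand x

/-- `locEval A [r] = ∫_{σ ∩ A} f`. [folklore] -/
@[simp] theorem locEval_of (A : ∀ k, Set (Fin k → ℝ)) (r : IntegralRep n) :
    locEval A (of r) = ∫ x in r.domain ∩ A n, r.integrand x :=
  FreeAbelianGroup.lift_apply_of _ _

/-- **Additivity moves preserve every localised evaluation** (for measurable test sets).
[folklore] -/
theorem addRelations_le_ker_locEval (A : ∀ k, Set (Fin k → ℝ)) (hA : ∀ k, MeasurableSet (A k)) :
    addRelations ≤ (locEval A).ker := by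
  refine (AddSubgroup.closure_le _).mpr ?_
  rintro c (hc | hc)
  · obtain ⟨k, r, r₁, r₂, hdom, hnull, h₁, h₂, rfl⟩ := hc
    have hm₁ : MeasurableSet r₁.domain := IntegralRep.measurableSet_domain_holds r₁
    have hm₂ : MeasurableSet r₂.domain := IntegralRep.measurableSet_domain_holds r₂
    simp only [SetLike.mem_coe, AddMonoidHom.mem_ker, map_sub, locEval_of]
    rw [sub_sub, sub_eq_zero, hdom, Set.union_inter_distrib_right]
    have hsub : (r₁.domain ∩ A k) ∩ (r₂.domain ∩ A k) ⊆ r₁.domain ∩ r₂.domain :=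
      fun x hx => ⟨hx.1.1, hx.2.1⟩
    have hae : AEDisjoint volume (r₁.domain ∩ A k) (r₂.domain ∩ A k) :=
      measure_mono_null hsub hnull
    have hint : IntegrableOn r.integrand (r₁.domain ∪ r₂.domain) := hdom ▸ r.integrableOn
    rw [setIntegral_union₀ hae ((hm₂.inter (hA k)).nullMeasurableSet)
        (hint.mono_set (inter_subset_left.trans subset_union_left))
        (hint.mono_set (inter_subset_left.trans subset_union_right)),
      setIntegral_congr_fun (hm₁.inter (hA k)) (h₁.mono inter_subset_left),
      setIntegral_congr_fun (hm₂.inter (hA k)) (h₂.mono inter_subset_left)]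
  · obtain ⟨k, r, r₁, r₂, h₁, h₂, hadd, rfl⟩ := hc
    have hm : MeasurableSet r.domain := IntegralRep.measurableSet_domain_holds r
    simp only [SetLike.mem_coe, AddMonoidHom.mem_ker, map_sub, locEval_of]
    rw [sub_sub, sub_eq_zero, setIntegral_congr_fun (hm.inter (hA k)) (hadd.mono inter_subset_left),
      h₁, h₂]
    exact integral_add ((h₁ ▸ r₁.integrableOn).mono_set inter_subset_left)
      ((h₂ ▸ r₂.integrableOn).mono_set inter_subset_left)

/-! ## §2 The test set `{z₁ < z₂}` separates `Δ₂ × Δ₂` from `Δ₄` -/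

/-- The test sets `A_k = {z | z₁ < z₂}` (empty for `k ≤ 2`). [folklore] -/
def Atest (k : ℕ) : Set (Fin k → ℝ) := {z | ∃ i j : Fin k, i.val = 1 ∧ j.val = 2 ∧ z i < z j}

/-- `Atest` as a finite union. [folklore] -/
theorem Atest_eq_iUnion (k : ℕ) :
    Atest k = ⋃ i : Fin k, ⋃ j : Fin k, {z | i.val = 1 ∧ j.val = 2 ∧ z i < z j} := by
  ext z
  simp [Atest]

/-- The test sets are measurable. [folklore] -/
theorem measurableSet_Atest (k : ℕ) : MeasurableSet (Atest k) := by
  rw [Atest_eq_iUnion]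
  refine MeasurableSet.iUnion fun i => MeasurableSet.iUnion fun j => ?_
  by_cases hi : i.val = 1
  · by_cases hj : j.val = 2
    · simpa [hi, hj] using measurableSet_lt (measurable_pi_apply i) (measurable_pi_apply j)
    · simp [hj]
  · simp [hi]

/-- The test sets are open. [folklore] -/
theorem isOpen_Atest (k : ℕ) : IsOpen (Atest k) := by
  rw [Atest_eq_iUnion]
  refine isOpen_iUnion fun i => isOpen_iUnion fun j => ?_
  by_cases hi : i.val = 1
  · by_cases hj : j.val = 2
    · simpa [hi, hj] using isOpen_lt (continuous_apply i) (continuous_apply j)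
    · simp [hj]
  · simp [hi]

/-- **The ordered simplex misses the test set** (`z₂ < z₁` there). [folklore] -/
theorem openOrderedSimplex_inter_Atest (w : ℕ) : openOrderedSimplex w ∩ Atest w = ∅ := by
  ext z
  simp only [mem_inter_iff, Atest, mem_setOf_eq, mem_empty_iff_false, iff_false, not_and]
  rintro ⟨-, -, hanti⟩ ⟨i, j, hi, hj, hlt⟩
  have hij : i < j := by
    rw [Fin.lt_def]
    omega
  exact lt_asymm hlt (hanti hij)

/-- Hence every simplex class is invisible to `locEval Atest`. [folklore] -/
theorem locEval_Atest_simplexOf (u : List ℕ) (hu : IsAdmissible u) :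
    locEval Atest (simplexOf u hu) = 0 := by
  rw [simplexOf, locEval_of, mzvRep_domain, openOrderedSimplex_inter_Atest]
  simp

/-- Kontsevich's integrand `∏ ω_{εᵢ}(tᵢ)` is positive on the open simplex. [folklore] -/
theorem mzvIntegrand_pos (s : List ℕ) {t : Fin (weight s) → ℝ}
    (ht : t ∈ openOrderedSimplex (weight s)) : 0 < mzvIntegrand s t :=
  Finset.prod_pos fun i _ => mzvForm_pos _ (ht.1 i) (ht.2.1 i)

/-- The product representation `Δ_s × Δ_t` behind `Z s * Z t` (Kontsevich–Zagier 2001, §4.1,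
Fubini). [folklore] -/
abbrev prodRep (s t : List ℕ) (hs : IsAdmissible s) (ht : IsAdmissible t) :
    IntegralRep (weight s + weight t) :=
  (mzvRep s hs (mzvIntegrand_isSemialgebraicFunOn_holds s) (mzvIntegrand_integrableOn_holds s hs)).prod
    (mzvRep t ht (mzvIntegrand_isSemialgebraicFunOn_holds t) (mzvIntegrand_integrableOn_holds t ht))

/-- `[Δ_s]·[Δ_t] = [Δ_s × Δ_t]` (`KZ.of_mul_of`). [folklore] -/
theorem simplexOf_mul_simplexOf {s t : List ℕ} (hs : IsAdmissible s) (ht : IsAdmissible t) :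
    simplexOf s hs * simplexOf t ht = of (prodRep s t hs ht) :=
  of_mul_of _ _

/-- The product integrand `ω_s ⊗ ω_t` is positive on `Δ_s × Δ_t`. [folklore] -/
theorem prodRep_integrand_pos {s t : List ℕ} (hs : IsAdmissible s) (ht : IsAdmissible t)
    {z : Fin (weight s + weight t) → ℝ} (hz : z ∈ (prodRep s t hs ht).domain) :
    0 < (prodRep s t hs ht).integrand z := by
  rw [IntegralRep.prod_integrand_eq, IntegralRep.prodFun_apply]
  simp only [IntegralRep.prod_domain, IntegralRep.mem_prodDomain, mzvRep_domain] at hz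
  exact mul_pos (mzvIntegrand_pos s hz.1) (mzvIntegrand_pos t hz.2)

/-- `Δ_s × Δ_t` is open. [folklore] -/
theorem isOpen_prodRep_domain {s t : List ℕ} (hs : IsAdmissible s) (ht : IsAdmissible t) :
    IsOpen (prodRep s t hs ht).domain := by
  rw [IntegralRep.prod_domain]
  have h1 : IsOpen ((fun z : Fin (weight s + weight t) → ℝ => fun i => z (Fin.castAdd (weight t) i)) ⁻¹'
      openOrderedSimplex (weight s)) :=
    (isOpen_openOrderedSimplex _).preimage (continuous_pi fun i => continuous_apply _)
  have h2 : IsOpen ((fun z : Fin (weight s + weight t) → ℝ => fun j => z (Fin.natAdd (weight s) j)) ⁻¹'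
      openOrderedSimplex (weight t)) :=
    (isOpen_openOrderedSimplex _).preimage (continuous_pi fun i => continuous_apply _)
  convert h1.inter h2 using 1
  rfl

/-- A rational point of `(Δ₂ × Δ₂) ∩ {z₁ < z₂}`: `(3/5, 1/5, 1/2, 1/10)`. [folklore] -/
def pt4 (k : ℕ) : ℝ := if k = 0 then 3 / 5 else if k = 1 then 1 / 5 else if k = 2 then 1 / 2 else 1 / 10

/-- The point `pt4` lies in `(Δ₂ × Δ₂) ∩ {z₁ < z₂}`. [folklore] -/
theorem pt4_mem :
    (fun i : Fin (weight [2] + weight [2]) => pt4 i.val) ∈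
      (prodRep [2] [2] (by decide) (by decide)).domain ∩ Atest (weight [2] + weight [2]) := by
  have hw : weight [2] = 2 := rfl
  constructor
  · simp only [IntegralRep.prod_domain, IntegralRep.mem_prodDomain, mzvRep_domain]
    refine ⟨⟨fun i => ?_, fun i => ?_, fun i j hij => ?_⟩, ⟨fun i => ?_, fun i => ?_, fun i j hij => ?_⟩⟩
    · obtain ⟨i, hi⟩ := i
      simp only [hw] at hi
      simp only [Fin.val_castAdd]
      interval_cases i <;> norm_num [pt4]
    · obtain ⟨i, hi⟩ := i
      simp only [hw] at hi
      simp only [Fin.val_castAdd]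
      interval_cases i <;> norm_num [pt4]
    · obtain ⟨i, hi⟩ := i
      obtain ⟨j, hj⟩ := j
      simp only [hw] at hi hj
      simp only [Fin.mk_lt_mk] at hij
      simp only [Fin.val_castAdd]
      interval_cases i
      all_goals interval_cases j
      all_goals norm_num [pt4] at hij ⊢
    · obtain ⟨i, hi⟩ := i
      simp only [hw] at hi
      simp only [Fin.val_natAdd, hw]
      interval_cases i <;> norm_num [pt4]
    · obtain ⟨i, hi⟩ := i
      simp only [hw] at hi
      simp only [Fin.val_natAdd, hw]
      interval_cases i <;> norm_num [pt4]
    · obtain ⟨i, hi⟩ := i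
      obtain ⟨j, hj⟩ := j
      simp only [hw] at hi hj
      simp only [Fin.mk_lt_mk] at hij
      simp only [Fin.val_natAdd, hw]
      interval_cases i
      all_goals interval_cases j
      all_goals norm_num [pt4] at hij ⊢
  · refine ⟨⟨1, by decide⟩, ⟨2, by decide⟩, rfl, rfl, ?_⟩
    norm_num [pt4]

/-- **The product class is visible to `locEval Atest`**: `∫_{(Δ₂×Δ₂) ∩ {z₁<z₂}} ω⊗ω > 0`
(positive integrand on a nonempty open set). [folklore] -/
theorem locEval_Atest_prodRep_two_two_pos :
    0 < locEval Atest (of (prodRep [2] [2] (by decide) (by decide))) := by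
  rw [locEval_of]
  set r := prodRep [2] [2] (by decide) (by decide) with hr
  have hmeas : MeasurableSet (r.domain ∩ Atest (weight [2] + weight [2])) :=
    (IntegralRep.measurableSet_domain_holds r).inter (measurableSet_Atest _)
  have hopen : IsOpen (r.domain ∩ Atest (weight [2] + weight [2])) :=
    (isOpen_prodRep_domain _ _).inter (isOpen_Atest _)
  have hne : (r.domain ∩ Atest (weight [2] + weight [2])).Nonempty := ⟨_, pt4_mem⟩
  have hnn : 0 ≤ᵐ[volume.restrict (r.domain ∩ Atest (weight [2] + weight [2]))] r.integrand :=
    ae_restrict_of_forall_mem hmeas fun z hz => (prodRep_integrand_pos _ _ hz.1).le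
  have hint : IntegrableOn r.integrand (r.domain ∩ Atest (weight [2] + weight [2])) :=
    r.integrableOn.mono_set inter_subset_left
  rw [setIntegral_pos_iff_support_of_nonneg_ae hnn hint]
  calc (0 : ENNReal) < volume (r.domain ∩ Atest (weight [2] + weight [2])) := hopen.measure_pos volume hne
    _ ≤ volume (Function.support r.integrand ∩ (r.domain ∩ Atest (weight [2] + weight [2]))) :=
        measure_mono fun z hz => ⟨(prodRep_integrand_pos _ _ hz.1).ne', hz⟩

/-- `locEval Atest` of the first genuine defect is positive. [folklore] -/
theorem locEval_Atest_defect_two_two_pos : 0 < locEval Atest (defect Zcan [2] [2]) := by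
  have h2 : IsAdmissible [2] := by decide
  rw [defect, map_sub, Zcan_of_isAdmissible [2] h2, simplexOf_mul_simplexOf, map_list_sum,
    List.map_map]
  have h0 : ∀ u ∈ stuffle [2] [2], (locEval Atest ∘ Zcan) u = 0 := fun u hu => by
    rw [Function.comp_apply, Zcan_of_isAdmissible u (isAdmissible_of_mem_stuffle h2 h2 hu),
      locEval_Atest_simplexOf]
  rw [List.map_congr_left h0, List.map_const', List.sum_replicate, smul_zero, sub_zero]
  exact locEval_Atest_prodRep_two_two_pos

/-! ## §3 The obstruction -/

/-- **The first genuine stuffle defect is not in the additivity-only closure.** [folklore] -/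
theorem defect_two_two_not_mem_addRelations : defect Zcan [2] [2] ∉ addRelations := fun h => by
  have h0 := addRelations_le_ker_locEval Atest measurableSet_Atest h
  rw [AddMonoidHom.mem_ker] at h0
  exact (locEval_Atest_defect_two_two_pos).ne' h0

/-- **Refuted strengthening**: the crux with `relations` replaced by the closure of the additivity
rules (1a) + (1b) is false — A CHANGE OF VARIABLES OR A NEWTON–LEIBNIZ MOVE IS NECESSARY in every
move chain for the stuffle. [folklore] -/
theorem not_stuffleInAdd :
    ¬ ∀ Z : List ℕ → FormalRep, (∀ (u : List ℕ) (hu : IsAdmissible u), Z u = simplexOf u hu) →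
      ∀ s t, IsAdmissible s → IsAdmissible t → defect Z s t ∈ addRelations := fun h =>
  defect_two_two_not_mem_addRelations (h Zcan Zcan_of_isAdmissible [2] [2] (by decide) (by decide))

end Summit.KontsevichZagierPeriods.Theorems.StuffleInKZ.Negative
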